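import Summits.QuantumFields.YangMills.Theorems.UnitScaleTiltProp7TwistedSliceGaugeCorrection
import HarnessLib

/-!
# Route `UnitScaleTilt`, crux K1 child «MinimiserStabilityRegPr» (stmt-QuantumFields-19200), skeleton v10, stub `stub_existenceMinimalOrbit` (EX), route (α) — brick T3 RE-EXPORTED FOR THE
# «SPLIT127-BRIDGE»: **the gauge correction of a slice-tangent velocity may be taken to be ANY fine gauge parameter extending the frame response** (in particular the zero extension, which
# is `𝔰𝔲(2)`-valued as soon as the frame response is)

Cell `ym3-torus`, width seat `ym3-torus-px5` (gen 3); EX namer ★w2-19200 g7 WORD (8) «px5 g3: SPLIT127-BRIDGE LOCATE GO» (2026-08-28 23:58Z), LOCATE-SPLIT127-BRIDGE-px5g3.md §1 (3′)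
(19200 evidence #57).  THEOREMS ONLY (0 `def`, 0 `sorry`); `--supports stmt-QuantumFields-19200 --as helper`, count-neutral.  YM₃ on T³ is a ladder rung (R3), not the Clay problem;
nothing here claims the stub, the crux, d = 4 or the mass gap.

WHY.  ★w5-20520 g6's ✓`Prop7TwistedSliceGaugeCorrection.exists_gaugeDir_QSym_velocity_sub_eq_zero_of_slice_tangent` (T3) produces SOME fine gauge parameter `N` with `N(x̂_y) = λ_α(y)` at the
comparison sites and `QSym U′ (Mα − G_{U′}N) = 0`; its proof takes the zero extension, but the statement hides it, so a consumer cannot read off that `N` is `𝔰𝔲(2)`-valued off the comparison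
sites.  Since ✓`Prop7SymAvgRelDiffT3.QSym_gaugeDir_of_regPr` reads `QSym U′ (G_{U′}N)` through `N ∘ x̂` ONLY, any two extensions of `λ_α` have the same image, hence the conclusion holds for
EVERY extension `N′` (§1), in particular for the zero extension, which is skew-Hermitian traceless at every site as soon as `λ_α` is (§2) — the legal (real) input the display's `hSplit′` wants.

WHAT IS PROVED (ns `…Theorems.Prop7TwistedSliceGaugeCorrectionAny`; letters of T3 VERBATIM): ★★ `QSym_velocity_sub_gaugeDir_eq_zero_of_extends` (any extension `N′ ⊇ λ_α`),
`extend_frameResponse_apply`∕`extend_frameResponse_of_not_mem` (the zero extension's values), ★★ `exists_su2_gaugeDir_QSym_velocity_sub_eq_zero` (if `λ_α(y)` is skew-Hermitian traceless for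
every comparison site `y`, there is an everywhere skew-Hermitian traceless `N` with `QSym U′ (Mα − G_{U′}N) = 0`).
HONEST SCOPE.  Linear bookkeeping over T3 and the gauge row; the reality of the frame response `λ_α` («FRAME-RESPONSE-SU2») is NOT here; nothing of `hSplit′`, EX or the crux is proved.

References: T. Bałaban, CMP 98 (1985) 17–51 [Balaban1985Averaging] ((11) p.19, (87) p.31, (97) p.32); CMP 102 (1985) 277–309 [Balaban1985Variational] ((44)–(49) p.285, (82)–(83) p.290).
-/

set_option autoImplicit false

noncomputable section

open scoped BigOperators Matrix.Norms.L2Operator Matrix Topology RightActions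
open Filter

namespace Summit.QuantumFields.YangMills.Theorems.Prop7TwistedSliceGaugeCorrectionAny

open NormedSpace
open Literature.MathematicalPhysics.QuantumFieldTheory.Balaban1983to89
open Literature.MathematicalPhysics.QuantumFieldTheory.Balaban1983to89.T3ContinuumYM3Torus
open Literature.MathematicalPhysics.QuantumFieldTheory.Balaban1983to89.T3SectALandauChart (bgUnits eta eta_pos)
open Literature.MathematicalPhysics.QuantumFieldTheory.Balaban1983to89.T3PrintedRegularMinimiser (RegPr)
open B7Prop1Explicit (expUnit val_expUnit)
open Summit.QuantumFields.YangMills.Theorems.Prop7SymAvgGL (descendToGL QSym)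
open Summit.QuantumFields.YangMills.Theorems.Prop7SymAvgTwSym (frameTwS dbarTwS logChartTwS)
open Literature.Analysis.Calculus.ExpDifferential (ad gSer)
open T3LevelShift (siteShift)
open T3PrintedRegularOrbits (sites_eq)
open B15DeterminingSets (embIter)
open Summit.QuantumFields.YangMills.Theorems.Prop7SymAvgRelDiffT3 (QSym_gaugeDir_of_regPr)
open Summit.QuantumFields.YangMills.Theorems.Prop7SymAvgTwSymSlice (embIter_injective)
open Summit.QuantumFields.YangMills.Theorems.Prop7TwistedSliceGaugeCorrection (exists_gaugeDir_QSym_velocity_sub_eq_zero_of_slice_tangent)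

variable (F : T3Family) {n K : ℕ} (h : n ≤ K)

/-! ## §1 Any extension of the frame response corrects the velocity -/

/-- ★★ **SLICE-TANGENT ⟹ FIBRE-TANGENT UP TO THE GAUGE DIRECTION OF ANY EXTENSION OF THE FRAME RESPONSE.**  In T3's setting (`U₀ ∈ 𝔘_k(ε₀)`, `U′ = e^{A₁}U₀ ∈ 𝔘_k(ε₀′)`, windows,
`‖A₁‖ < e·η`, `D(logChartTwS U₀)(A₁) α = 0`): for EVERY fine gauge parameter `N′` with `N′(x̂_y) = λ_α(y)` at the comparison sites, `QSym U′ (Mα − G_{U′}N′) = 0`.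
[cite: Balaban1985Averaging, (11) p.19, (87) p.31, (97) p.32; Balaban1985Variational, (44)-(49) p.285, (82)-(83) p.290] -/
theorem QSym_velocity_sub_gaugeDir_eq_zero_of_extends {ε₀ ε₀' e : ℝ} (hε₀ : 0 < ε₀) (he : 0 < e) (hWe : 10 ^ 9 * (F.L : ℝ) ^ 2 * e ≤ 1) (hWε : 10 ^ 12 * (F.L : ℝ) ^ 3 * ε₀ ≤ 1)
    (hε₀' : 0 < ε₀') (hε' : 10 ^ 7 * (F.L : ℝ) ^ 3 * ε₀' ≤ 1)
    (U₀ U' : GaugeField (F.P K) 0 (Matrix.specialUnitaryGroup (Fin 2) ℂ)) (hreg : RegPr F n K ε₀ U₀) (hreg' : RegPr F n K ε₀' U')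
    (A₁ : PBond (F.P K) 0 → Matrix (Fin 2) (Fin 2) ℂ) (hA₁ : ‖A₁‖ < e * eta F n K)
    (hU' : ∀ b, ((U' b : Matrix.specialUnitaryGroup (Fin 2) ℂ) : Matrix (Fin 2) (Fin 2) ℂ) = exp (A₁ b) * ((U₀ b : Matrix.specialUnitaryGroup (Fin 2) ℂ) : Matrix (Fin 2) (Fin 2) ℂ))
    (α : PBond (F.P K) 0 → Matrix (Fin 2) (Fin 2) ℂ) (hα : fderiv ℂ (logChartTwS F n K h U₀) A₁ α = 0)
    (N' : Site (F.P K) 0 → Matrix (Fin 2) (Fin 2) ℂ)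
    (hN' : ∀ y : Site (F.P n) 0, N' (embIter (K - n) (siteShift (sites_eq F n K h) y))
          = fderiv ℂ (fun A : PBond (F.P K) 0 → Matrix (Fin 2) (Fin 2) ℂ => ((frameTwS F n K h U₀ A y : (Matrix (Fin 2) (Fin 2) ℂ)ˣ) : Matrix (Fin 2) (Fin 2) ℂ)) A₁ α *
              (((frameTwS F n K h U₀ A₁ y)⁻¹ : (Matrix (Fin 2) (Fin 2) ℂ)ˣ) : Matrix (Fin 2) (Fin 2) ℂ)) :
    QSym F n K h U' ((fun b : PBond (F.P K) 0 => gSer ℂ (ad ℂ (-A₁ b)) (α b))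
        - fun b : PBond (F.P K) 0 => N' b.src - ((bgUnits F K U' b : (Matrix (Fin 2) (Fin 2) ℂ)ˣ) : Matrix (Fin 2) (Fin 2) ℂ) * N' b.tgt *
            (((bgUnits F K U' b)⁻¹ : (Matrix (Fin 2) (Fin 2) ℂ)ˣ) : Matrix (Fin 2) (Fin 2) ℂ)) = 0 := by
  obtain ⟨N, hN, hQ⟩ := exists_gaugeDir_QSym_velocity_sub_eq_zero_of_slice_tangent F h hε₀ he hWe hWε hε₀' hε' U₀ U' hreg hreg' A₁ hA₁ hU' α hα
  -- both gauge directions have the same straight average: it reads `N ∘ x̂ = λ_α = N′ ∘ x̂` only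
  have hG := QSym_gaugeDir_of_regPr F h hε₀' hε' U' hreg' N
  have hG' := QSym_gaugeDir_of_regPr F h hε₀' hε' U' hreg' N'
  have hGG : QSym F n K h U' (fun b : PBond (F.P K) 0 => N b.src - ((bgUnits F K U' b : (Matrix (Fin 2) (Fin 2) ℂ)ˣ) : Matrix (Fin 2) (Fin 2) ℂ) * N b.tgt *
            (((bgUnits F K U' b)⁻¹ : (Matrix (Fin 2) (Fin 2) ℂ)ˣ) : Matrix (Fin 2) (Fin 2) ℂ))
      = QSym F n K h U' (fun b : PBond (F.P K) 0 => N' b.src - ((bgUnits F K U' b : (Matrix (Fin 2) (Fin 2) ℂ)ˣ) : Matrix (Fin 2) (Fin 2) ℂ) * N' b.tgt *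
            (((bgUnits F K U' b)⁻¹ : (Matrix (Fin 2) (Fin 2) ℂ)ˣ) : Matrix (Fin 2) (Fin 2) ℂ)) := by
    rw [hG, hG']
    funext c
    rw [hN c.src, hN c.tgt, hN' c.src, hN' c.tgt]
  rw [map_sub] at hQ ⊢
  rw [← hGG]
  exact hQ

/-! ## §2 The zero extension; reality -/

/-- The comparison sites `y ↦ x̂_y = embIter (K − n) (siteShift … y)` are pairwise distinct. [cite: Balaban1985Averaging, (11) p.19] -/
theorem comparisonSite_injective : Function.Injective fun y : Site (F.P n) 0 => embIter (K - n) (siteShift (sites_eq F n K h) y) := by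
  have hKn : K - n ≤ (F.P K).m + (F.P K).K := by
    show K - n ≤ F.m + K
    have := F.hm
    omega
  exact fun a b hab => (siteShift (sites_eq F n K h)).injective (embIter_injective (K - n) hKn hab)

/-- The zero extension of a coarse site function agrees with it at the comparison sites. [folklore] -/
theorem extend_comparisonSite_apply (lam : Site (F.P n) 0 → Matrix (Fin 2) (Fin 2) ℂ) (y : Site (F.P n) 0) :
    Function.extend (fun y : Site (F.P n) 0 => embIter (K - n) (siteShift (sites_eq F n K h) y)) lam 0 (embIter (K - n) (siteShift (sites_eq F n K h) y)) = lam y :=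
  (comparisonSite_injective F h).extend_apply lam 0 y

/-- The zero extension of an `𝔰𝔲(2)`-valued coarse site function is `𝔰𝔲(2)`-valued at EVERY fine site (value `λ(y)` at `x̂_y`, `0` elsewhere). [folklore] -/
theorem extend_comparisonSite_skew_traceless (lam : Site (F.P n) 0 → Matrix (Fin 2) (Fin 2) ℂ) (hlam : ∀ y, star (lam y) = -lam y ∧ (lam y).trace = 0)
    (x : Site (F.P K) 0) :
    star (Function.extend (fun y : Site (F.P n) 0 => embIter (K - n) (siteShift (sites_eq F n K h) y)) lam 0 x)
        = -Function.extend (fun y : Site (F.P n) 0 => embIter (K - n) (siteShift (sites_eq F n K h) y)) lam 0 x ∧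
      (Function.extend (fun y : Site (F.P n) 0 => embIter (K - n) (siteShift (sites_eq F n K h) y)) lam 0 x).trace = 0 := by
  by_cases hx : ∃ y : Site (F.P n) 0, embIter (K - n) (siteShift (sites_eq F n K h) y) = x
  · obtain ⟨y, rfl⟩ := hx
    rw [extend_comparisonSite_apply F h lam y]
    exact hlam y
  · rw [Function.extend_apply' _ _ _ hx]
    change star (0 : Matrix (Fin 2) (Fin 2) ℂ) = -0 ∧ (0 : Matrix (Fin 2) (Fin 2) ℂ).trace = 0
    simp

/-- ★★ **AN `𝔰𝔲(2)`-VALUED GAUGE CORRECTION**: in T3's setting, if the frame response `λ_α(y)` is skew-Hermitian traceless at every comparison site (the «FRAME-RESPONSE-SU2» brick: the symmetric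
accumulated frames are SU(2)-valued along real chart rays, ✓`Prop7SymFrameUnitary`), then there is an EVERYWHERE skew-Hermitian traceless fine gauge parameter `N` with
`QSym U′ (Mα − G_{U′}N) = 0` — so `Mα − G_{U′}N` is a legal (real) argument of the display's `hSplit′` once `Mα` is real.
[cite: Balaban1985Averaging, (11) p.19, (87) p.31, (97) p.32; Balaban1985Variational, (51) p.286, (82)-(83) p.290] -/
theorem exists_su2_gaugeDir_QSym_velocity_sub_eq_zero {ε₀ ε₀' e : ℝ} (hε₀ : 0 < ε₀) (he : 0 < e) (hWe : 10 ^ 9 * (F.L : ℝ) ^ 2 * e ≤ 1) (hWε : 10 ^ 12 * (F.L : ℝ) ^ 3 * ε₀ ≤ 1)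
    (hε₀' : 0 < ε₀') (hε' : 10 ^ 7 * (F.L : ℝ) ^ 3 * ε₀' ≤ 1)
    (U₀ U' : GaugeField (F.P K) 0 (Matrix.specialUnitaryGroup (Fin 2) ℂ)) (hreg : RegPr F n K ε₀ U₀) (hreg' : RegPr F n K ε₀' U')
    (A₁ : PBond (F.P K) 0 → Matrix (Fin 2) (Fin 2) ℂ) (hA₁ : ‖A₁‖ < e * eta F n K)
    (hU' : ∀ b, ((U' b : Matrix.specialUnitaryGroup (Fin 2) ℂ) : Matrix (Fin 2) (Fin 2) ℂ) = exp (A₁ b) * ((U₀ b : Matrix.specialUnitaryGroup (Fin 2) ℂ) : Matrix (Fin 2) (Fin 2) ℂ))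
    (α : PBond (F.P K) 0 → Matrix (Fin 2) (Fin 2) ℂ) (hα : fderiv ℂ (logChartTwS F n K h U₀) A₁ α = 0)
    (hlamR : ∀ y : Site (F.P n) 0,
      star (fderiv ℂ (fun A : PBond (F.P K) 0 → Matrix (Fin 2) (Fin 2) ℂ => ((frameTwS F n K h U₀ A y : (Matrix (Fin 2) (Fin 2) ℂ)ˣ) : Matrix (Fin 2) (Fin 2) ℂ)) A₁ α *
              (((frameTwS F n K h U₀ A₁ y)⁻¹ : (Matrix (Fin 2) (Fin 2) ℂ)ˣ) : Matrix (Fin 2) (Fin 2) ℂ))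
        = -(fderiv ℂ (fun A : PBond (F.P K) 0 → Matrix (Fin 2) (Fin 2) ℂ => ((frameTwS F n K h U₀ A y : (Matrix (Fin 2) (Fin 2) ℂ)ˣ) : Matrix (Fin 2) (Fin 2) ℂ)) A₁ α *
              (((frameTwS F n K h U₀ A₁ y)⁻¹ : (Matrix (Fin 2) (Fin 2) ℂ)ˣ) : Matrix (Fin 2) (Fin 2) ℂ)) ∧
      (fderiv ℂ (fun A : PBond (F.P K) 0 → Matrix (Fin 2) (Fin 2) ℂ => ((frameTwS F n K h U₀ A y : (Matrix (Fin 2) (Fin 2) ℂ)ˣ) : Matrix (Fin 2) (Fin 2) ℂ)) A₁ α *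
              (((frameTwS F n K h U₀ A₁ y)⁻¹ : (Matrix (Fin 2) (Fin 2) ℂ)ˣ) : Matrix (Fin 2) (Fin 2) ℂ)).trace = 0) :
    ∃ N : Site (F.P K) 0 → Matrix (Fin 2) (Fin 2) ℂ, (∀ x, star (N x) = -N x ∧ (N x).trace = 0) ∧
      QSym F n K h U' ((fun b : PBond (F.P K) 0 => gSer ℂ (ad ℂ (-A₁ b)) (α b))
          - fun b : PBond (F.P K) 0 => N b.src - ((bgUnits F K U' b : (Matrix (Fin 2) (Fin 2) ℂ)ˣ) : Matrix (Fin 2) (Fin 2) ℂ) * N b.tgt *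
              (((bgUnits F K U' b)⁻¹ : (Matrix (Fin 2) (Fin 2) ℂ)ˣ) : Matrix (Fin 2) (Fin 2) ℂ)) = 0 := by
  refine ⟨Function.extend (fun y : Site (F.P n) 0 => embIter (K - n) (siteShift (sites_eq F n K h) y))
      (fun y => fderiv ℂ (fun A : PBond (F.P K) 0 → Matrix (Fin 2) (Fin 2) ℂ => ((frameTwS F n K h U₀ A y : (Matrix (Fin 2) (Fin 2) ℂ)ˣ) : Matrix (Fin 2) (Fin 2) ℂ)) A₁ α *
              (((frameTwS F n K h U₀ A₁ y)⁻¹ : (Matrix (Fin 2) (Fin 2) ℂ)ˣ) : Matrix (Fin 2) (Fin 2) ℂ)) 0,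
    extend_comparisonSite_skew_traceless F h _ hlamR, ?_⟩
  exact QSym_velocity_sub_gaugeDir_eq_zero_of_extends F h hε₀ he hWe hWε hε₀' hε' U₀ U' hreg hreg' A₁ hA₁ hU' α hα _
    (fun y => extend_comparisonSite_apply F h _ y)

end Summit.QuantumFields.YangMills.Theorems.Prop7TwistedSliceGaugeCorrectionAny

end
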